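import Mathlib.Algebra.Algebra.Rat
import Mathlib.FieldTheory.IntermediateField.Basic
import Mathlib.LinearAlgebra.Dimension.Finrank
import Mathlib.LinearAlgebra.FiniteDimensional.Defs
import Mathlib.LinearAlgebra.Prod
import Mathlib.Data.Real.Basic
import HarnessLib

/-!
# Roy 1992 over a general field: the statements of Theorems 1, 2 and 4 as predicates

Topic `Literature/NumberTheory/Transcendental` (namespace `Literature.NumberTheory.Transcendental`,
grouping sub-namespace `RoyRank` — Roy's rank/dimension theory for linear forms in logarithms).
Source: D. Roy, *Matrices whose coefficients are linear forms in logarithms*, J. Number Theory 41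
(1992) 22–47 [`Roy1992`]: Notations (p. 24), §1 Theorems 1–2 (p. 25), §4 Theorem 4 (p. 34) and
Remark (i) (p. 37).

## Why a general field

Roy works simultaneously with `K = ℂ` and `K = ℂ_p` ("Let `ℚ̄` be an algebraic closure of `ℚ`, and
let `K` be the field `ℂ` or `ℂ_p`", p. 22; Notations p. 24), with `L ⊆ K` the `ℚ`-space generated
by the logarithms of algebraic numbers, `ω = 2πi` if `K = ℂ` and `ω = 0` otherwise, and he notes
(§4 Remark (i), p. 37): "Let `F` be a subfield of `ℚ̄`. Theorem 4 remains valid if we substitute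
everywhere in its statement `F` to `ℚ̄` and `F + F·L` to `𝓛̃`. The proof is the same provided that
we make the same substitutions." His deductions Theorem 1 ⟹ Theorem 2 (§§2–3) and Theorem 2 ⟹
Theorem 4 (§4) are pure linear algebra over the data

  `K` a field of characteristic `0` · `F ⊆ K` a subfield (playing `ℚ̄`) · `L ⊆ K` a `ℚ`-subspace
  (playing `L`) · `ω ∈ K` (playing `ω`, through `Ω = 0 × ωℚ^{d₁}`),

the only transcendence input being Theorem 1 (M. Waldschmidt, Theorem 4.1 of [Waldschmidt1988]
for the group `G_a^{d₀} × G_m^{d₁}`, over `ℂ` and over `ℂ_p`). The tree has the whole chain for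
`K = ℂ` hard-wired to `ℂ` (`Literature.Barriers.Schanuel.roy1992_thm1/thm2/thm4`, with
`roy1992_thm4_of_thm2`, `roy1992_thm2` from `roy1992_thm1` in the `…RoyThm2FromThm1` companion), and
the `p`-adic statements as named facts (`Literature.NumberTheory.Transcendental.roy1992_padic_thm4`,
`K = ℚ̄_p`). This file states the three theorems ONCE over the general data, as PREDICATES of
`(K, F, L, ω)` — statement schemas, not assertions: `RoyRank.Thm1 F L ω`, `RoyRank.Thm2 F L ω`,
`RoyRank.Thm4 F L` — so that the companions can prove Roy's implications
`Thm1 F L ω → Thm2 F L ω → Thm4 F L` once, and specialise them to `K = ℚ̄_p`, `F = ℚ̄`,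
`L = logQSpan p`, `ω = 0` (and, if wanted, to `K = ℂ`). Nothing is asserted in this file.

## What the source prints

* [Roy1992, Notations p. 24]: for `F' ⊂ F` fields and an `F`-space `V` with `F'`-structure `V'`,
  "an `F`-vector subspace `T` of `V` is rational over `F'` if it is generated (over `F`) by elements
  of `V'`", "`f : V₁ → V₂` is rational over `F'` if `f(V₁') ⊆ V₂'`"; "For each integer `d > 0`, we
  put on the `K`-vector space `K^d` the `ℚ̄`-structure `ℚ̄^d` and the `ℚ`-structure `ℚ^d`";
  "`𝓛̃ = ℚ̄ + ℚ̄·L`".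
* [Roy1992, §1 Theorem 1 (M. Waldschmidt), p. 25]: "Let `d₀, d₁` be integers `≥ 0`, `Y` be a
  finite dimensional `ℚ`-vector subspace of `K^{d₀} × K^{d₁}` contained in `ℚ̄^{d₀} × L^{d₁}`, `W`
  be a `K`-vector subspace of `K^{d₀} × K^{d₁}` which is rational over `ℚ̄`, `V` be a `K`-vector
  subspace of `K^{d₀} × K^{d₁}` containing `Y` and `W`. If `V ≠ K^{d₀} × K^{d₁}`, there exists a
  surjective `K`-linear mapping `s : K^{d₀} × K^{d₁} → K^{d₀'} × K^{d₁'}` satisfying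
  `s(ℚ̄^{d₀} × 0) ⊆ ℚ̄^{d₀'} × 0` and `s(0 × ℚ^{d₁}) ⊆ 0 × ℚ^{d₁'}`, such that, letting `Y' = s(Y)`,
  `W' = s(W)`, `V' = s(V)`, `Ω = 0 × ωℚ^{d₁}`, and `Ω' = 0 × ωℚ^{d₁'}`, we have
  `W' ≠ K^{d₀'} × K^{d₁'}` and
  `(d₁' − dim_ℚ(Y' ∩ Ω') + dim_ℚ(Y'))/(d₀' + d₁' − dim_K(W')) ≤ (d₁ − dim_ℚ(Y ∩ Ω))/(d₀ + d₁ − dim_K(V))`."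
* [Roy1992, §1 Theorem 2, p. 25]: "Let `d₀, d₁, Y, W, V` be as in Theorem 1, with
  `V ≠ K^{d₀} × K^{d₁}`. Consider the set of all surjective `K`-linear mappings
  `s : K^{d₀} × K^{d₁} → K^{d₀'} × K^{d₁'}` satisfying `s(ℚ̄^{d₀} × 0) ⊆ ℚ̄^{d₀'} × 0`,
  `s(0 × ℚ^{d₁}) ⊆ 0 × ℚ^{d₁'}`, `s(V) ≠ K^{d₀'} × K^{d₁'}`. In this set, there exists at least one
  mapping `s` for which the ratio `d₁'/(d₀' + d₁' − dim_K(s(V)))` is minimal, and for which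
  `s(V) ∩ (ℚ̄^{d₀'} × 0) = 0`. For such an `s`, we have
  `(d₁' + dim_ℚ(s(Y)))/(d₀' + d₁' − dim_K(s(W))) ≤ d₁'/(d₀' + d₁' − dim_K(s(V))) ≤ (d₁ − dim_ℚ(Y ∩ Ω))/(d₀ + d₁ − dim_K(V))`."
* [Roy1992, §4 Theorem 4, p. 34]: "Let `d` be a positive integer, `Z` be a finite dimensional
  `ℚ̄`-vector subspace of `𝓛̃^d`, and `U` be a `K`-vector subspace of `K^d` containing `Z`. Among
  the set of all surjective `K`-linear mappings `t : K^d → K^{d'}` which are rational over `ℚ̄` and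
  non-zero, we choose one for which the ratio `dim_K(t(U))/d'` is minimal. Then, letting
  `Z' = t(Z)` and `U' = t(U)`, we have `dim_ℚ̄(Z')/(d' + dim_ℚ̄(Z')) ≤ dim_K(U')/d' ≤ dim_K(U)/d`."

## Lean rendering (same shapes as the tree's `K = ℂ` and `K = ℚ̄_p` renderings)

`K` is any field of characteristic `0` (a `ℚ`-algebra through `DivisionRing.toRatAlgebra`, as `ℂ` and
`ℚ̄_p` are in the tree); `F : IntermediateField ℚ K`; `L : Submodule ℚ K`; `ω : K`.
`LinTangent K d₀ d₁ = (Fin d₀ → K) × (Fin d₁ → K)`; `IsFPoint F v` (`v ∈ F^{d₀} × F^{d₁}`);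
`IsFRational F W` (`W` is the `K`-span of its `F`-points); `Omega ω d₀ d₁` (`Ω = 0 × ωℚ^{d₁}` as a
`ℚ`-submodule); `IsAdmissible F s` (surjective, `s(F^{d₀} × 0) ⊆ F^{d₀'} × 0`,
`s(0 × ℚ^{d₁}) ⊆ 0 × ℚ^{d₁'}`, the `ℚ`-points being `Set.range (algebraMap ℚ K)`);
`IsFLogSubspace F L Y` (`Y ⊆ F^{d₀} × L^{d₁}`); `Thm1 F L ω`, `thm2Ratio`, `IsThm2Minimal F`,
`Thm2 F L ω` — verbatim transcriptions of `Literature.Barriers.Schanuel.roy1992_thm1`, `thm2Ratio`,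
`IsThm2Minimal`, `roy1992_thm2` with `ℂ ↦ K`, `ℚ̄ ↦ F`, `{z | e^z ∈ ℚ̄} ↦ L`, `2πi ↦ ω`; on `K^d`:
`IsRationalMap F t` (`t(F^{d₁}) ⊆ F^{d₂}`), `linForms F L = span_F ({1} ∪ L)` (`= F + F·L`, Roy's
`𝓛̃` when `F = ℚ̄`), `Thm4 F L` — verbatim the shape of `roy1992_thm4` / `roy1992_padic_thm4`; and
`IsMinimalTwo F d U`, Roy's minimality property (2) of the proof of Theorem 4 (p. 34). All
dimensions are cast to `ℝ` (no natural subtraction).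

## References

* [Roy1992] D. Roy, J. Number Theory 41 (1992) 22–47: Notations p. 24; §1 Theorems 1–2 (p. 25);
  §4 Theorem 4 (p. 34), proof (2) (p. 34), Remark (i) (p. 37).
* [Waldschmidt1988] M. Waldschmidt, *On the transcendence methods of Gel'fond and Schneider in
  several variables*, New Advances in Transcendence Theory (1988), Thm 4.1 (the source of Theorem 1).
-/

noncomputable section

open Module

namespace Literature.NumberTheory.Transcendental.RoyRank

/-! ### The space `K^{d₀} × K^{d₁}` and its rational structures -/

/-- The tangent space `K^{d₀} × K^{d₁}` of the linear group `G_a^{d₀} × G_m^{d₁}` at the neutral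
element, over a general field `K`. [cite: Roy1992, §1 (before Theorem 1, p. 25)] -/
abbrev LinTangent (K : Type*) (d₀ d₁ : ℕ) : Type _ := (Fin d₀ → K) × (Fin d₁ → K)

variable {K : Type*} [Field K] [CharZero K]
variable {d₀ d₁ d₀' d₁' : ℕ}

/-- `v ∈ F^{d₀} × F^{d₁}` (all coordinates in the subfield `F`; Roy: `F = ℚ̄`).
[cite: Roy1992, Notations (p. 24)] -/
def IsFPoint (F : IntermediateField ℚ K) (v : LinTangent K d₀ d₁) : Prop :=
  (∀ i, v.1 i ∈ F) ∧ ∀ j, v.2 j ∈ F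

/-- A `K`-subspace `W ⊆ K^{d₀} × K^{d₁}` is **rational over `F`** if it is generated over `K` by
elements of `F^{d₀} × F^{d₁}` (equivalently: `W` is the `K`-span of its own `F`-points).
[cite: Roy1992, Notations (p. 24)] -/
def IsFRational (F : IntermediateField ℚ K) (W : Submodule K (LinTangent K d₀ d₁)) : Prop :=
  W = Submodule.span K {v | v ∈ W ∧ IsFPoint F v}

/-- `Ω = 0 × ωℚ^{d₁}`: the `ℚ`-subspace of `K^{d₀} × K^{d₁}` spanned by the vectors `(0, ω·e_j)`
(`ω = 2πi` if `K = ℂ`, `ω = 0` otherwise, when `Ω = 0`). [cite: Roy1992, §1 Theorem 1 (p. 25) and Notations (p. 24)] -/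
def Omega (ω : K) (d₀ d₁ : ℕ) : Submodule ℚ (LinTangent K d₀ d₁) :=
  Submodule.span ℚ (Set.range fun j : Fin d₁ => ((0 : Fin d₀ → K), Pi.single j ω))

/-- The maps `s : K^{d₀} × K^{d₁} → K^{d₀'} × K^{d₁'}` of Theorems 1–2: surjective, `K`-linear, with
`s(F^{d₀} × 0) ⊆ F^{d₀'} × 0` and `s(0 × ℚ^{d₁}) ⊆ 0 × ℚ^{d₁'}` (`ℚ ⊆ K` through `algebraMap ℚ K`).
[cite: Roy1992, §1 Theorem 1 (p. 25)] -/
def IsAdmissible (F : IntermediateField ℚ K)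
    (s : LinTangent K d₀ d₁ →ₗ[K] LinTangent K d₀' d₁') : Prop :=
  Function.Surjective s ∧
    (∀ x : Fin d₀ → K, (∀ i, x i ∈ F) → (∀ i, (s (x, 0)).1 i ∈ F) ∧ (s (x, 0)).2 = 0) ∧
    (∀ y : Fin d₁ → K, (∀ j, y j ∈ Set.range (algebraMap ℚ K)) →
      (s (0, y)).1 = 0 ∧ ∀ j, (s (0, y)).2 j ∈ Set.range (algebraMap ℚ K))

/-- `Y ⊆ F^{d₀} × L^{d₁}`: the first `d₀` coordinates of every element of `Y` lie in `F` and the last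
`d₁` lie in `L`. [cite: Roy1992, §1 Theorem 1 (p. 25)] -/
def IsFLogSubspace (F : IntermediateField ℚ K) (L : Submodule ℚ K)
    (Y : Submodule ℚ (LinTangent K d₀ d₁)) : Prop :=
  ∀ y ∈ Y, (∀ i, y.1 i ∈ F) ∧ ∀ j, y.2 j ∈ L

/-- The identity is admissible. [folklore] -/
theorem isAdmissible_id (F : IntermediateField ℚ K) (d₀ d₁ : ℕ) :
    IsAdmissible F (LinearMap.id : LinTangent K d₀ d₁ →ₗ[K] LinTangent K d₀ d₁) :=
  ⟨Function.surjective_id, fun _ hx => ⟨hx, rfl⟩, fun _ hy => ⟨rfl, hy⟩⟩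

/-- The zero subspace is rational over `F`. [folklore] -/
theorem isFRational_bot (F : IntermediateField ℚ K) :
    IsFRational F (⊥ : Submodule K (LinTangent K d₀ d₁)) := by
  unfold IsFRational
  refine le_antisymm bot_le (Submodule.span_le.2 ?_)
  rintro v ⟨hv, -⟩
  exact hv

/-! ### Theorem 1 (M. Waldschmidt) and Theorem 2 (Roy) as predicates of `(K, F, L, ω)` -/

/-- **Roy 1992, Theorem 1 (M. Waldschmidt), for the data `(K, F, L, ω)`** — the statement schema
of [Waldschmidt1988, Thm 4.1] for `G_a^{d₀} × G_m^{d₁}` in Roy's formulation: "Let `d₀, d₁` be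
integers `≥ 0`, `Y` be a finite dimensional `ℚ`-vector subspace of `K^{d₀} × K^{d₁}` contained in
`ℚ̄^{d₀} × L^{d₁}`, `W` be a `K`-vector subspace of `K^{d₀} × K^{d₁}` which is rational over `ℚ̄`,
`V` be a `K`-vector subspace of `K^{d₀} × K^{d₁}` containing `Y` and `W`. If `V ≠ K^{d₀} × K^{d₁}`,
there exists a surjective `K`-linear mapping `s : K^{d₀} × K^{d₁} → K^{d₀'} × K^{d₁'}` satisfying
`s(ℚ̄^{d₀} × 0) ⊆ ℚ̄^{d₀'} × 0` and `s(0 × ℚ^{d₁}) ⊆ 0 × ℚ^{d₁'}`, such that, letting `Y' = s(Y)`,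
`W' = s(W)`, `V' = s(V)`, `Ω = 0 × ωℚ^{d₁}`, and `Ω' = 0 × ωℚ^{d₁'}`, we have
`W' ≠ K^{d₀'} × K^{d₁'}` and
`(d₁' − dim_ℚ(Y' ∩ Ω') + dim_ℚ(Y'))/(d₀' + d₁' − dim_K(W')) ≤ (d₁ − dim_ℚ(Y ∩ Ω))/(d₀ + d₁ − dim_K(V))`",
with `ℚ̄ ↦ F`, `L ↦ L`, `ω ↦ ω`. A PREDICATE (nothing asserted): for `K = ℂ`, `F = ℚ̄`,
`L = {z | e^z ∈ ℚ̄}`, `ω = 2πi` it is the shape of the tree's named fact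
`Literature.Barriers.Schanuel.roy1992_thm1`; for `K = ℂ_p` (`ω = 0`) it is the `p`-adic case of
Waldschmidt's theorem, which the tree does not have. Dimensions cast to `ℝ`.
[cite: Roy1992, §1 Theorem 1 (p. 25)] [cite: Waldschmidt1988, §4 Theorem 4.1] -/
def Thm1 (F : IntermediateField ℚ K) (L : Submodule ℚ K) (ω : K) : Prop :=
  ∀ (d₀ d₁ : ℕ) (Y : Submodule ℚ (LinTangent K d₀ d₁)) (W V : Submodule K (LinTangent K d₀ d₁)),
    FiniteDimensional ℚ Y → IsFLogSubspace F L Y → IsFRational F W →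
    Y ≤ V.restrictScalars ℚ → W ≤ V → V ≠ ⊤ →
    ∃ (d₀' d₁' : ℕ) (s : LinTangent K d₀ d₁ →ₗ[K] LinTangent K d₀' d₁'), IsAdmissible F s ∧
      W.map s ≠ ⊤ ∧
      ((d₁' : ℝ) - finrank ℚ ↥(Y.map (s.restrictScalars ℚ) ⊓ Omega ω d₀' d₁')
          + finrank ℚ ↥(Y.map (s.restrictScalars ℚ))) /
          ((d₀' : ℝ) + d₁' - finrank K ↥(W.map s)) ≤
        ((d₁ : ℝ) - finrank ℚ ↥(Y ⊓ Omega ω d₀ d₁)) / ((d₀ : ℝ) + d₁ - finrank K ↥V)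

/-- The ratio `d₁'/(d₀' + d₁' − dim_K(s(V)))` minimised in Theorem 2. [cite: Roy1992, §1 Theorem 2 (p. 25)] -/
def thm2Ratio (V : Submodule K (LinTangent K d₀ d₁)) (d₀' d₁' : ℕ)
    (s : LinTangent K d₀ d₁ →ₗ[K] LinTangent K d₀' d₁') : ℝ :=
  (d₁' : ℝ) / ((d₀' : ℝ) + d₁' - finrank K ↥(V.map s))

/-- The set of maps considered in Theorem 2 (admissible `s` with `s(V) ≠ K^{d₀'} × K^{d₁'}`) and the
minimality of the ratio `d₁'/(d₀' + d₁' − dim_K(s(V)))` over that set.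
[cite: Roy1992, §1 Theorem 2 (p. 25)] -/
def IsThm2Minimal (F : IntermediateField ℚ K) (V : Submodule K (LinTangent K d₀ d₁)) (d₀' d₁' : ℕ)
    (s : LinTangent K d₀ d₁ →ₗ[K] LinTangent K d₀' d₁') : Prop :=
  IsAdmissible F s ∧ V.map s ≠ ⊤ ∧
    ∀ (d₀'' d₁'' : ℕ) (s' : LinTangent K d₀ d₁ →ₗ[K] LinTangent K d₀'' d₁''),
      IsAdmissible F s' → V.map s' ≠ ⊤ → thm2Ratio V d₀' d₁' s ≤ thm2Ratio V d₀'' d₁'' s'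

/-- **Roy 1992, Theorem 2, for the data `(K, F, L, ω)`** (Roy's refinement of Theorem 1, proved in
§§2–3 from it): "Let `d₀, d₁, Y, W, V` be as in Theorem 1, with `V ≠ K^{d₀} × K^{d₁}`. Consider the
set of all surjective `K`-linear mappings `s : K^{d₀} × K^{d₁} → K^{d₀'} × K^{d₁'}` satisfying
`s(ℚ̄^{d₀} × 0) ⊆ ℚ̄^{d₀'} × 0`, `s(0 × ℚ^{d₁}) ⊆ 0 × ℚ^{d₁'}`, `s(V) ≠ K^{d₀'} × K^{d₁'}`. In this
set, there exists at least one mapping `s` for which the ratio `d₁'/(d₀' + d₁' − dim_K(s(V)))` is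
minimal, and for which `s(V) ∩ (ℚ̄^{d₀'} × 0) = 0`. For such an `s`, we have
`(d₁' + dim_ℚ(s(Y)))/(d₀' + d₁' − dim_K(s(W))) ≤ d₁'/(d₀' + d₁' − dim_K(s(V))) ≤ (d₁ − dim_ℚ(Y ∩ Ω))/(d₀ + d₁ − dim_K(V))`,
letting `Ω = 0 × ωℚ^{d₁}`", with `ℚ̄ ↦ F`. Rendered, as the tree's `roy1992_thm2` (`K = ℂ`), as the
conjunction of the existence statement and of the inequalities for every minimising `s` with
`s(V) ∩ (F^{d₀'} × 0) = 0`. A PREDICATE (nothing asserted). [cite: Roy1992, §1 Theorem 2 (p. 25)] -/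
def Thm2 (F : IntermediateField ℚ K) (L : Submodule ℚ K) (ω : K) : Prop :=
  ∀ (d₀ d₁ : ℕ) (Y : Submodule ℚ (LinTangent K d₀ d₁)) (W V : Submodule K (LinTangent K d₀ d₁)),
    FiniteDimensional ℚ Y → IsFLogSubspace F L Y → IsFRational F W →
    Y ≤ V.restrictScalars ℚ → W ≤ V → V ≠ ⊤ →
    (∃ (d₀' d₁' : ℕ) (s : LinTangent K d₀ d₁ →ₗ[K] LinTangent K d₀' d₁'),
      IsThm2Minimal F V d₀' d₁' s ∧
      ∀ v ∈ V.map s, (∀ i, v.1 i ∈ F) → v.2 = 0 → v = 0) ∧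
    ∀ (d₀' d₁' : ℕ) (s : LinTangent K d₀ d₁ →ₗ[K] LinTangent K d₀' d₁'),
      IsThm2Minimal F V d₀' d₁' s →
      (∀ v ∈ V.map s, (∀ i, v.1 i ∈ F) → v.2 = 0 → v = 0) →
      ((d₁' : ℝ) + finrank ℚ ↥(Y.map (s.restrictScalars ℚ))) /
            ((d₀' : ℝ) + d₁' - finrank K ↥(W.map s)) ≤ thm2Ratio V d₀' d₁' s ∧
        thm2Ratio V d₀' d₁' s ≤
          ((d₁ : ℝ) - finrank ℚ ↥(Y ⊓ Omega ω d₀ d₁)) / ((d₀ : ℝ) + d₁ - finrank K ↥V)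

/-! ### `K^d` with its `F`-structure: rational maps, `F + F·L`, Theorem 4 -/

/-- A `K`-linear map `t : K^{d₁} → K^{d₂}` is **rational over `F`** if `t(F^{d₁}) ⊆ F^{d₂}` (the same
body as the tree's `Literature.Barriers.Schanuel.IsRationalMap` for `K = ℂ` and
`Literature.NumberTheory.Transcendental.RoyPadic.IsRationalMap` for `K = ℚ̄_p`, `F = ℚ̄`).
[cite: Roy1992, Notations (p. 24)] -/
def IsRationalMap (F : IntermediateField ℚ K) {d₁ d₂ : ℕ}
    (t : (Fin d₁ → K) →ₗ[K] (Fin d₂ → K)) : Prop :=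
  ∀ v : Fin d₁ → K, (∀ i, v i ∈ F) → ∀ j, t v j ∈ F

/-- **`F + F·L`**, the `F`-span of `1` and of `L` — Roy's `𝓛̃ = ℚ̄ + ℚ̄·L` for `F = ℚ̄` (the linear
forms in logarithms with algebraic coefficients), and the space of §4 Remark (i) in general.
[cite: Roy1992, Notations (p. 24) and §4 Remark (i) (p. 37)] -/
def linForms (F : IntermediateField ℚ K) (L : Submodule ℚ K) : Submodule F K :=
  Submodule.span F ({1} ∪ (L : Set K))

/-- `1 ∈ F + F·L`. [folklore] -/
theorem one_mem_linForms (F : IntermediateField ℚ K) (L : Submodule ℚ K) :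
    (1 : K) ∈ linForms F L :=
  Submodule.subset_span (Set.mem_union_left _ rfl)

/-- `L ⊆ F + F·L`. [folklore] -/
theorem mem_linForms_of_mem (F : IntermediateField ℚ K) (L : Submodule ℚ K) {x : K} (hx : x ∈ L) :
    x ∈ linForms F L :=
  Submodule.subset_span (Set.mem_union_right _ hx)

/-- **Roy 1992, Theorem 4, for the data `(K, F, L)`** (§4 Remark (i): "Theorem 4 remains valid if we
substitute everywhere in its statement `F` to `ℚ̄` and `F + F·L` to `𝓛̃`"): "Let `d` be a positive
integer, `Z` be a finite dimensional `ℚ̄`-vector subspace of `𝓛̃^d`, and `U` be a `K`-vector subspace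
of `K^d` containing `Z`. Among the set of all surjective `K`-linear mappings `t : K^d → K^{d'}` which
are rational over `ℚ̄` and non-zero, we choose one for which the ratio `dim_K(t(U))/d'` is minimal.
Then, letting `Z' = t(Z)` and `U' = t(U)`, we have
`dim_ℚ̄(Z')/(d' + dim_ℚ̄(Z')) ≤ dim_K(U')/d' ≤ dim_K(U)/d`", with `ℚ̄ ↦ F`, `𝓛̃ ↦ linForms F L`, the
conclusion asserted for every minimising `t` — literally the shape of the tree's `roy1992_thm4`
(`K = ℂ`) and `roy1992_padic_thm4` (`K = ℚ̄_p`). A PREDICATE (nothing asserted).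
[cite: Roy1992, §4 Theorem 4 (p. 34) and Remark (i) (p. 37)] -/
def Thm4 (F : IntermediateField ℚ K) (L : Submodule ℚ K) : Prop :=
  ∀ (d : ℕ), 0 < d →
  ∀ (Z : Submodule F (Fin d → K)) (U : Submodule K (Fin d → K)),
    Module.Finite F Z →
    (∀ z ∈ Z, ∀ i, z i ∈ linForms F L) →
    Z ≤ U.restrictScalars F →
  ∀ (d' : ℕ) (t : (Fin d → K) →ₗ[K] (Fin d' → K)),
    Function.Surjective t → IsRationalMap F t → t ≠ 0 →
    (∀ (d'' : ℕ) (t' : (Fin d → K) →ₗ[K] (Fin d'' → K)),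
        Function.Surjective t' → IsRationalMap F t' → t' ≠ 0 →
        (finrank K (U.map t) : ℝ) / d' ≤ (finrank K (U.map t') : ℝ) / d'') →
    (finrank F (Z.map (t.restrictScalars F)) : ℝ) /
        (d' + finrank F (Z.map (t.restrictScalars F))) ≤
      (finrank K (U.map t) : ℝ) / d' ∧
    (finrank K (U.map t) : ℝ) / d' ≤ (finrank K U : ℝ) / d

/-- Roy's minimality property (2) of `U ⊆ K^d` (case `d' = d` of the proof of Theorem 4):
`dim_K(U)/d ≤ dim_K(t₁(U))/d₁` for every surjective non-zero `t₁ : K^d → K^{d₁}` rational over `F`.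
[cite: Roy1992, §4 proof of Theorem 4, (2) (p. 34)] -/
def IsMinimalTwo (F : IntermediateField ℚ K) (d : ℕ) (U : Submodule K (Fin d → K)) : Prop :=
  ∀ (d₁ : ℕ) (t₁ : (Fin d → K) →ₗ[K] (Fin d₁ → K)), Function.Surjective t₁ → IsRationalMap F t₁ →
    t₁ ≠ 0 → (finrank K U : ℝ) / d ≤ (finrank K (U.map t₁) : ℝ) / d₁

/-- The identity map of `K^d` is rational over `F`. [folklore] -/
theorem isRationalMap_id (F : IntermediateField ℚ K) (d : ℕ) :
    IsRationalMap F (LinearMap.id : (Fin d → K) →ₗ[K] (Fin d → K)) :=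
  fun _ hv j => hv j

/-- Composition of maps rational over `F` is rational over `F`. [folklore] -/
theorem isRationalMap_comp (F : IntermediateField ℚ K) {d₁ d₂ d₃ : ℕ}
    {t : (Fin d₁ → K) →ₗ[K] (Fin d₂ → K)}
    {t' : (Fin d₂ → K) →ₗ[K] (Fin d₃ → K)} (ht : IsRationalMap F t) (ht' : IsRationalMap F t') :
    IsRationalMap F (t' ∘ₗ t) :=
  fun v hv j => ht' _ (ht v hv) j

end Literature.NumberTheory.Transcendental.RoyRank
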